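import Summits.MatrixMultiplication.MatrixMultiplication.Theorems.SaturationLadderFrameShadows
import Summits.MatrixMultiplication.MatrixMultiplication.Theorems.SaturationLadderFrameLift
import Summits.MatrixMultiplication.MatrixMultiplication.Theorems.SaturationLadderShadowDegenerations
import Literature.Computability.AlgebraicComplexity.MatrixMultiplicationExponent
import HarnessLib

/-!
# Full block lists under the frame square: `(6,1,1,1)`, `(7,1,1)`, `(4,3,1,1)`, `(5,3,1)` are degenerations of `P_{2,3}^{⊠2}`
# (route `SaturationLadder`, item stmt-MatrixMultiplication-25909 `SubexpSaturation`; cell `decomp-mm`, lens 1, gen 36)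

PROVED, 0 sorry; no definitions, no instances, no notation, no named facts; route-free (imports the gen-33/34/35
kernels `SaturationLadderFrameShadows` (`frameTensor`), `SaturationLadderFrameLift` (node collision
`frameTensor_degeneratesTo_frameTensor_indicator`), `SaturationLadderShadowDegenerations` (the monomially weighted
sandwich `isApproxRestriction_of_monomialWeights`), `Literature` and Mathlib only).

SETTING.  The moment-curve frame `P_{2,3}(0,1,−1) = frameTensor K 2 3 ![0,1,-1]` is the diagonal-type tensor
`Σ_z e_z ⊗ (1, λ_z) ⊗ e_z`; its Kronecker square `P^{⊠2}` (format `9 × 4 × 9`, positions `(z,z') ∈ Fin 3 × Fin 3`,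
multiplier monomials `λ^k μ^{k'}`, `(k,k') ∈ Fin 2 × Fin 2`, `λ = λ_z`, `μ = λ_{z'}`) is `Σ_j e_j ⊗ x_j ⊗ e_j` with the
nine points `x_{(z,z')} = (1, λ_z, λ_{z'}, λ_z λ_{z'})` — the `3 × 3` Segre grid in `K⁴`.  For a set partition of the
nine positions into classes `S_σ` (class map `cls`, a FULL block list `e = (|S_σ|)_σ ⊢ 9`), the **partition tensor**
`T_cls := Σ_j e_j ⊗ e_{cls j} ⊗ e_j`, written below literally as
`fun z σ y => if y = z ∧ σ = cls z then 1 else 0`, is the direct sum `⊕_σ ⟨1,1,|S_σ|⟩` (the tree's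
`matMulDirectSum K 1 1 e` up to relabelling positions; independent scalar multipliers, one per block).
The cell's level-2 LINEAR-CLASS LEDGER (memo g35 §2, census v27) asked which full lists `e` satisfy
`T_e ⊴ P_{2,3}^{⊠2}` beyond the mergings of `D ⊠ D = (4,2,2,1)` inherited from level one (gen-34 Theorem A), and in
particular (memo g35 §5 (n1)/(n2)) whether `U1-cash(2)` is empty.

THIS FILE (kernel side of memo `NODE-SaturationLadder-g36.md`):
* §0 the collapsing lemma for a sandwich of the frame square between a scaled one-hot position matrix, an
  arbitrary multiplier matrix and a one-hot position matrix (an evaluation of a bilinear form at a grid point),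
  and the one-hot/one-hot collapse used for merging classes;
* §1 `P^{⊠2} ⊴₁ T_(6,1,1,1)` — classes: the six off-diagonal positions | `(0,0)` | `(1,1)` | `(2,2)` (the singletons
  sit on a TRANSVERSAL); multiplier rows `λ − μ` (weight 0; vanishes exactly on the diagonal) and
  `ε(λ−1)(μ+1)`, `ελ(μ+1)`, `ελ(μ−1)` (weight 1; each vanishes at the two other diagonal points);
* §2 `P^{⊠2} ⊴₁ T_(7,1,1)` — singletons `(0,1)`, `(1,0)` (a non-attacking pair); rows `1 − λ − μ` (weight 0, vanishes
  exactly at the two singletons), `ε(λ−1)`, `ε(μ−1)`;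
* §3 `P^{⊠2} ⊴₂ T_(4,3,1,1)` — classes: the `2 × 2` subgrid `{1,2}²` | `{(0,0),(0,2),(2,0)}` | `(0,1)` | `(1,0)`; rows
  `λμ` (weight 0), `ε(1−λ−μ)` (weight 1), `ε²(λ−1)`, `ε²(μ−1)` (weight 2);
  in all three the position matrices are `ε^{h − weight(cls j)}·(value)⁻¹` (one-hot) and the identity, so the
  certificates are instances of `isApproxRestriction_of_monomialWeights` (`36` evaluations each, `simp`/`norm_num`);
* §4 merging two classes is a restriction (`T_(4,3,1,1) ≥ T_(5,3,1)`, one-hot matrices, every field), whence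
  `P^{⊠2} ⊴ T_(5,3,1)` (classes: subgrid `∪ {(0,1)}` | `{(0,0),(0,2),(2,0)}` | `(1,0)`) by `AlgDegeneratesTo.trans_restrictsTo`;
* §5 the inherited list: `P_{2,m}(λ)^{⊠2} ⊴ P_{2,m}(δ_{z₀})^{⊠2}` (`= (m−1,1) ⊠ (m−1,1)`, for `m = 3` the list
  `(4,2,2,1)`) for every field, every `m`, pairwise distinct nodes — Theorem A squared by `AlgDegeneratesTo.kronecker`;
* `_complex` corollaries over the summit's field.
Characteristic `0` is assumed in §1–§4 (the normalising constants `1/2`, `1/3` and the node set `{0, 1, −1}`).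

BY HAND (memo g36 §1–§2, NOT typed here; tags BY-HAND / EXACT).  (i) DEPTH CRITERION: for a diagonal-type tensor
`T_X = Σ_j e_j ⊗ x_j ⊗ e_j` (`x_j ∈ K^a ∖ 0`, `K` an infinite field) and a block list `e = (e_σ)_σ` with `Σ_σ e_σ = |J|`,
`T_X ⊵ ⊕_σ ⟨1,1,e_σ⟩` iff SOME set partition `cls` of the positions `J` with block sizes `e` admits a depth function
`n : J → ℕ` with `x_j ∉ span{x_{j'} : n_{j'} > n_j, or n_{j'} = n_j and cls j' ≠ cls j}` for every `j` (since
`T_cls ≅ T_cls'` whenever the block sizes agree, the condition is on the list `e`; for a labelled `cls` it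
characterises the degenerations `ε^h T_cls + O(ε^{h+1}) = (A_ε ⊗ B_ε ⊗ C_ε)T_X` in which position `j` of `T_X`
carries position `j` of `T_cls` to leading order)
(⟸: for each class a multiplier row `q_σ(ε) = Σ_k ε^k q_{σ,k}` whose `ε`-order at `x_j` is `n_j` if `cls j = σ`
and `> n_j` otherwise — it exists iff every superlevel set of the prescribed order function is closed under taking
`K`-span inside `X`, which is the displayed condition — and position weights `ε^{h−n_j}` as in §1–§3; this is a
combinatorial degeneration in the sense of BCS (15.30) in an adapted basis of the multiplier leg, followed by a
merging of classes as in §4; ⟹: contracting the multiplier leg of `(A_ε ⊗ B_ε ⊗ C_ε)T_X = ε^h T_cls + O(ε^{h+1})`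
with a generic `φ ∈ (K^s)^*` and taking determinants gives `det A_ε · det C_ε · Π_j φ(B_ε x_j) = ε^{|J|h}(Π_σ φ_σ^{e_σ} + O(ε))`,
so by unique factorisation in `K[ε][φ]` every `B_ε x_j` has a leading vector on a coordinate axis `e_{cls' j}` with
`|cls'⁻¹(σ)| = e_σ`, i.e. the row-order functions `m_{σ j} = ord_ε (B_ε x_j)_σ` attain their minimum over `σ` exactly
at `cls' j`; with `n_j := min_σ m_{σ j}` the forms `q_σ := ` row `σ` of `B_ε` witness the displayed condition for
`cls'`); equivalently GREEDY PEELING (remove, for some class, the largest sub-class `G` with `G ∩ span(J ∖ G) = ∅`;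
iterate over some partition with block sizes `e`) empties `J`.  (ii) LEVEL-2 CLASSIFICATION (criterion +
exhaustive exact peeling over all `11051` set partitions of the grid into `≤ 4` classes, `gen36/peel_g36.py`): a full
list `e ⊢ 9` with `≤ 4` parts satisfies `T_e ⊴ P_{2,3}^{⊠2}` iff `e ∉ {(3,3,3), (3,3,2,1), (3,2,2,2), (5,2,1,1)}`, i.e.
iff `e` is a merging of one of the three `≼`-maximal lists `(4,2,2,1)` (§5), `(4,3,1,1)` (§3), `(6,1,1,1)` (§1); the
four lists `(7,1,1), (6,1,1,1), (5,3,1), (4,3,1,1)` are NOT mergings of `(4,2,2,1)`, and every full list other than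
`(9)` is `F^θ`-excluded from the shadow square `N_{2,3}^{⊠2}` (memo g35 §2 slope lemma, by hand) — so
`U1-cash(2) ≠ ∅` (memo g35 §5 (n2) answered YES; (n1): `(3,2,2,2)` is NOT a degeneration of the frame square).
Value caveat (critic l.1949 (a)): every `T_e` has rank `= border rank = 9 = Σ e` and is `≤ ⟨9⟩`; these are
SEPARATORS between frame and shadow in degeneration currency, not upper-bound improvements, and carry no `ω`
consequence.
-/

open scoped BigOperators Polynomial

namespace Summit.MatrixMultiplication.MatrixMultiplication.Theorems.SaturationLadderFrameSquareDegenerations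

open Literature.Computability.AlgebraicComplexity Polynomial
open Summit.MatrixMultiplication.MatrixMultiplication.Theorems.SaturationLadderFrameShadows
open Summit.MatrixMultiplication.MatrixMultiplication.Theorems.SaturationLadderFrameLift
open Summit.MatrixMultiplication.MatrixMultiplication.Theorems.SaturationLadderShadowDegenerations

universe u

variable {K : Type u} [Field K]

/-! ## §0 Bookkeeping: sandwiches of the frame square against one-hot position matrices -/

/-- A sandwich of the frame square `P_{a,m}(λ)^{⊠2}` between a scaled one-hot output matrix (row `a'` reads
position `a'` with the scalar `v a'`), an arbitrary multiplier matrix `B₀` and a one-hot input matrix is the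
evaluation `[a' = c'] · v(a') · Σ_b B₀(b',b) λ_{a'₁}^{b₁} λ_{a'₂}^{b₂}` of the bilinear form `B₀(b', ·)` at the grid
point `a'`. [folklore] -/
theorem sum_frameSq_sandwich {β : Type*} {a m : ℕ} (lam : Fin m → K) (v : Fin m × Fin m → K)
    (B₀ : β → Fin a × Fin a → K) (a' c' : Fin m × Fin m) (b' : β) :
    (∑ x : Fin m × Fin m, ∑ b : Fin a × Fin a, ∑ c : Fin m × Fin m,
      (if x = a' then v a' else 0) * B₀ b' b * (if c = c' then (1 : K) else 0) *
        kroneckerTensor (frameTensor K a m lam) (frameTensor K a m lam) x b c) =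
    if a' = c' then v a' * ∑ b : Fin a × Fin a, B₀ b' b * (lam a'.1 ^ (b.1 : ℕ) * lam a'.2 ^ (b.2 : ℕ))
    else 0 := by
  classical
  have inner : ∀ (x : Fin m × Fin m) (b : Fin a × Fin a), (∑ c : Fin m × Fin m,
      (if x = a' then v a' else 0) * B₀ b' b * (if c = c' then (1 : K) else 0) *
        kroneckerTensor (frameTensor K a m lam) (frameTensor K a m lam) x b c) =
      (if x = a' then v a' else 0) * B₀ b' b *
        kroneckerTensor (frameTensor K a m lam) (frameTensor K a m lam) x b c' := by
    intro x b
    rw [Finset.sum_eq_single c' (fun c _ hc => by simp [hc]) (fun h => absurd (Finset.mem_univ _) h)]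
    simp
  simp_rw [inner]
  rw [Finset.sum_eq_single a' (fun x _ hx => by simp [hx]) (fun h => absurd (Finset.mem_univ _) h)]
  simp only [if_true]
  by_cases h : a' = c'
  · subst h
    rw [if_pos rfl, Finset.mul_sum]
    refine Finset.sum_congr rfl fun b _ => ?_
    simp only [kroneckerTensor_apply, frameTensor_apply, if_true]
    ring
  · rw [if_neg h]
    have h' : c'.1 ≠ a'.1 ∨ c'.2 ≠ a'.2 := by
      by_contra hh
      simp only [not_or, not_not] at hh
      exact h (Prod.ext hh.1.symm hh.2.symm)
    refine Finset.sum_eq_zero fun b _ => ?_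
    rcases h' with h' | h' <;> simp [kroneckerTensor_apply, frameTensor_apply, h']

/-- A restriction sum against one-hot output and input matrices (identity relabelling of positions) and an
arbitrary multiplier column `g` is the `g`-weighted sum of the source entries at those positions. [folklore] -/
theorem sum_oneHot_positions {ι κ μ : Type*} [Fintype ι] [Fintype κ] [Fintype μ] [DecidableEq ι]
    [DecidableEq μ] (s : ι → κ → μ → K) (g : κ → K) (a₀ : ι) (c₀ : μ) :
    (∑ a, ∑ b, ∑ c, (if a = a₀ then (1 : K) else 0) * g b * (if c = c₀ then (1 : K) else 0) * s a b c) =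
      ∑ b, g b * s a₀ b c₀ := by
  rw [Finset.sum_eq_single a₀ (fun a _ ha => by simp [ha]) (by simp)]
  simp only [if_true, one_mul]
  refine Finset.sum_congr rfl fun b _ => ?_
  rw [Finset.sum_eq_single c₀ (fun c _ hc => by simp [hc]) (by simp)]
  simp

/-! ## §1 `(6,1,1,1)`: the singletons on a transversal -/

/-- **`P_{2,3}(0,1,−1)^{⊠2} ⊴ ⟨1,1,6⟩ ⊕ ⟨1⟩ ⊕ ⟨1⟩ ⊕ ⟨1⟩` (order `1`, characteristic `0`).**  Classes (table
`cls`, row `z`, column `z'`): off-diagonal positions `↦ 0`, `(i,i) ↦ i+1`.  Multiplier rows (coefficients of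
`1, μ | λ, λμ` in `T σ`): `q₀ = λ − μ` (weight `0`; on the grid it vanishes exactly on the diagonal),
`q₁ = (λ−1)(μ+1)`, `q₂ = λ(μ+1)`, `q₃ = λ(μ−1)` (weight `1`; `q_{i+1}` vanishes at the two diagonal points other than
`(i,i)`); output matrix `ε^{γ}·v` one-hot with `γ = 0` on the diagonal, `1` off it, and `v = (q_{cls j}(x_j))⁻¹`
(table `vT`); input matrix the identity.  Depth function of the criterion: `0` off the diagonal, `1` on it.
[cite: BurgisserClausenShokrollahi1997, (15.19)] -/
theorem frameTensor_sq_degeneratesTo_list6111 [CharZero K] :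
    AlgDegeneratesTo
      (kroneckerTensor (frameTensor K 2 3 ![0, 1, -1]) (frameTensor K 2 3 ![0, 1, -1]))
      (fun (z : Fin 3 × Fin 3) (σ : Fin 4) (y : Fin 3 × Fin 3) =>
        if y = z ∧ σ = (![![1, 0, 0], ![0, 2, 0], ![0, 0, 3]] : Fin 3 → Fin 3 → Fin 4) z.1 z.2
        then (1 : K) else 0) := by
  classical
  let cls : Fin 3 → Fin 3 → Fin 4 := ![![1, 0, 0], ![0, 2, 0], ![0, 0, 3]]
  let vT : Fin 3 → Fin 3 → K :=
    ![![-1, -1, 1], ![1, (1 : K) / 2, (1 : K) / 2], ![-1, (-1 : K) / 2, (1 : K) / 2]]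
  let T : Fin 4 → Fin 2 → Fin 2 → K :=
    ![![![0, -1], ![1, 0]], ![![-1, -1], ![1, 1]], ![![0, 0], ![1, 1]], ![![0, 0], ![-1, 1]]]
  let v : Fin 3 × Fin 3 → K := fun p => vT p.1 p.2
  let V : Fin 3 × Fin 3 → Fin 3 × Fin 3 → K := fun a' x => if x = a' then v a' else 0
  let B₀ : Fin 4 → Fin 2 × Fin 2 → K := fun σ b => T σ b.1 b.2
  let W : Fin 3 × Fin 3 → Fin 3 × Fin 3 → K := fun c' c => if c = c' then 1 else 0
  let γ : Fin 3 × Fin 3 → ℕ := fun a' => if a'.1 = a'.2 then 0 else 1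
  let β : Fin 4 → ℕ := ![0, 1, 1, 1]
  let α : Fin 3 × Fin 3 → ℕ := fun _ => 0
  have hM : ∀ a' b' c', γ a' + β b' + α c' ≤ 1 →
      (∑ a, ∑ b, ∑ c, V a' a * B₀ b' b * W c' c *
        kroneckerTensor (frameTensor K 2 3 ![0, 1, -1]) (frameTensor K 2 3 ![0, 1, -1]) a b c) =
      if γ a' + β b' + α c' = 1 then
        (if c' = a' ∧ b' = cls a'.1 a'.2 then (1 : K) else 0) else 0 := by
    intro a' b' c'
    simp only [V, W]
    rw [sum_frameSq_sandwich (![0, 1, -1] : Fin 3 → K) v B₀ a' c' b']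
    by_cases hac : a' = c'
    · subst hac
      obtain ⟨z, z'⟩ := a'
      fin_cases z <;> fin_cases z' <;> fin_cases b' <;>
        simp [γ, β, α, cls, v, vT, B₀, T, Fintype.sum_prod_type, Fin.sum_univ_two] <;> norm_num
    · have hca : ¬ (c' = a') := fun h => hac h.symm
      simp [hac, hca]
  have ht : ∀ a' b' c', γ a' + β b' + α c' ≠ 1 →
      (if c' = a' ∧ b' = cls a'.1 a'.2 then (1 : K) else 0) = 0 := by
    intro a' b' c' hw
    obtain ⟨z, z'⟩ := a'
    split_ifs with hcond
    · exfalso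
      apply hw
      obtain ⟨-, rfl⟩ := hcond
      fin_cases z <;> fin_cases z' <;> simp [γ, β, α, cls]
    · rfl
  exact ⟨1, _, _, _, isApproxRestriction_of_monomialWeights hM ht⟩

/-! ## §2 `(7,1,1)`: two singletons on a non-attacking pair -/

/-- **`P_{2,3}(0,1,−1)^{⊠2} ⊴ ⟨1,1,7⟩ ⊕ ⟨1⟩ ⊕ ⟨1⟩` (order `1`, characteristic `0`).**  Classes: `(0,1) ↦ 1`,
`(1,0) ↦ 2` (grid points `(λ,μ) = (0,1), (1,0)`), all other positions `↦ 0`.  Rows: `q₀ = 1 − λ − μ` (weight `0`;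
vanishes on the grid exactly at the two singletons), `q₁ = λ − 1`, `q₂ = μ − 1` (weight `1`; `q₁` vanishes at
`(1,0)`, `q₂` at `(0,1)`); output matrix `ε^{γ}·v`, `γ = 0` on the singletons and `1` elsewhere.  Depth function:
`0` on the big class, `1` on the singletons. [cite: BurgisserClausenShokrollahi1997, (15.19)] -/
theorem frameTensor_sq_degeneratesTo_list711 [CharZero K] :
    AlgDegeneratesTo
      (kroneckerTensor (frameTensor K 2 3 ![0, 1, -1]) (frameTensor K 2 3 ![0, 1, -1]))
      (fun (z : Fin 3 × Fin 3) (σ : Fin 3) (y : Fin 3 × Fin 3) =>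
        if y = z ∧ σ = (![![0, 1, 0], ![2, 0, 0], ![0, 0, 0]] : Fin 3 → Fin 3 → Fin 3) z.1 z.2
        then (1 : K) else 0) := by
  classical
  let cls : Fin 3 → Fin 3 → Fin 3 := ![![0, 1, 0], ![2, 0, 0], ![0, 0, 0]]
  let vT : Fin 3 → Fin 3 → K :=
    ![![1, -1, (1 : K) / 2], ![-1, -1, 1], ![(1 : K) / 2, 1, (1 : K) / 3]]
  let T : Fin 3 → Fin 2 → Fin 2 → K :=
    ![![![1, -1], ![-1, 0]], ![![-1, 0], ![1, 0]], ![![-1, 1], ![0, 0]]]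
  let v : Fin 3 × Fin 3 → K := fun p => vT p.1 p.2
  let V : Fin 3 × Fin 3 → Fin 3 × Fin 3 → K := fun a' x => if x = a' then v a' else 0
  let B₀ : Fin 3 → Fin 2 × Fin 2 → K := fun σ b => T σ b.1 b.2
  let W : Fin 3 × Fin 3 → Fin 3 × Fin 3 → K := fun c' c => if c = c' then 1 else 0
  let γ : Fin 3 × Fin 3 → ℕ := fun a' => if cls a'.1 a'.2 = 0 then 1 else 0
  let β : Fin 3 → ℕ := ![0, 1, 1]
  let α : Fin 3 × Fin 3 → ℕ := fun _ => 0
  have hM : ∀ a' b' c', γ a' + β b' + α c' ≤ 1 →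
      (∑ a, ∑ b, ∑ c, V a' a * B₀ b' b * W c' c *
        kroneckerTensor (frameTensor K 2 3 ![0, 1, -1]) (frameTensor K 2 3 ![0, 1, -1]) a b c) =
      if γ a' + β b' + α c' = 1 then
        (if c' = a' ∧ b' = cls a'.1 a'.2 then (1 : K) else 0) else 0 := by
    intro a' b' c'
    simp only [V, W]
    rw [sum_frameSq_sandwich (![0, 1, -1] : Fin 3 → K) v B₀ a' c' b']
    by_cases hac : a' = c'
    · subst hac
      obtain ⟨z, z'⟩ := a'
      fin_cases z <;> fin_cases z' <;> fin_cases b' <;>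
        simp [γ, β, α, cls, v, vT, B₀, T, Fintype.sum_prod_type, Fin.sum_univ_two] <;> norm_num
    · have hca : ¬ (c' = a') := fun h => hac h.symm
      simp [hac, hca]
  have ht : ∀ a' b' c', γ a' + β b' + α c' ≠ 1 →
      (if c' = a' ∧ b' = cls a'.1 a'.2 then (1 : K) else 0) = 0 := by
    intro a' b' c' hw
    obtain ⟨z, z'⟩ := a'
    split_ifs with hcond
    · exfalso
      apply hw
      obtain ⟨-, rfl⟩ := hcond
      fin_cases z <;> fin_cases z' <;> simp [γ, β, α, cls]
    · rfl
  exact ⟨1, _, _, _, isApproxRestriction_of_monomialWeights hM ht⟩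

/-! ## §3 `(4,3,1,1)`: subgrid | three cross points | two singletons -/

/-- **`P_{2,3}(0,1,−1)^{⊠2} ⊴ ⟨1,1,4⟩ ⊕ ⟨1,1,3⟩ ⊕ ⟨1⟩ ⊕ ⟨1⟩` (order `2`, characteristic `0`).**  Classes: the subgrid
`{1,2} × {1,2}` (nodes `±1`) `↦ 0`; `(0,0), (0,2), (2,0) ↦ 1`; `(0,1) ↦ 2`; `(1,0) ↦ 3`.  Rows: `q₀ = λμ` (weight `0`;
vanishes exactly on the cross `λμ = 0`), `q₁ = 1 − λ − μ` (weight `1`; vanishes at `(0,1), (1,0)`),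
`q₂ = λ − 1`, `q₃ = μ − 1` (weight `2`); output weights `γ = 2 − weight(class)` (table), `v = (q_{cls j}(x_j))⁻¹`.
Depth function: `0 | 1 | 2 | 2`.  The list `(4,3,1,1)` is not a merging of `(4,2,2,1)`; by hand (memo g35 §2) it is
`F^θ`-excluded from `N_{2,3}^{⊠2}` with margin `0.25`. [cite: BurgisserClausenShokrollahi1997, (15.19)] -/
theorem frameTensor_sq_degeneratesTo_list4311 [CharZero K] :
    AlgDegeneratesTo
      (kroneckerTensor (frameTensor K 2 3 ![0, 1, -1]) (frameTensor K 2 3 ![0, 1, -1]))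
      (fun (z : Fin 3 × Fin 3) (σ : Fin 4) (y : Fin 3 × Fin 3) =>
        if y = z ∧ σ = (![![1, 2, 1], ![3, 0, 0], ![1, 0, 0]] : Fin 3 → Fin 3 → Fin 4) z.1 z.2
        then (1 : K) else 0) := by
  classical
  let cls : Fin 3 → Fin 3 → Fin 4 := ![![1, 2, 1], ![3, 0, 0], ![1, 0, 0]]
  let vT : Fin 3 → Fin 3 → K :=
    ![![1, -1, (1 : K) / 2], ![-1, 1, -1], ![(1 : K) / 2, -1, 1]]
  let T : Fin 4 → Fin 2 → Fin 2 → K :=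
    ![![![0, 0], ![0, 1]], ![![1, -1], ![-1, 0]], ![![-1, 0], ![1, 0]], ![![-1, 1], ![0, 0]]]
  let gT : Fin 3 → Fin 3 → ℕ := ![![1, 0, 1], ![0, 2, 2], ![1, 2, 2]]
  let v : Fin 3 × Fin 3 → K := fun p => vT p.1 p.2
  let V : Fin 3 × Fin 3 → Fin 3 × Fin 3 → K := fun a' x => if x = a' then v a' else 0
  let B₀ : Fin 4 → Fin 2 × Fin 2 → K := fun σ b => T σ b.1 b.2
  let W : Fin 3 × Fin 3 → Fin 3 × Fin 3 → K := fun c' c => if c = c' then 1 else 0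
  let γ : Fin 3 × Fin 3 → ℕ := fun a' => gT a'.1 a'.2
  let β : Fin 4 → ℕ := ![0, 1, 2, 2]
  let α : Fin 3 × Fin 3 → ℕ := fun _ => 0
  have hM : ∀ a' b' c', γ a' + β b' + α c' ≤ 2 →
      (∑ a, ∑ b, ∑ c, V a' a * B₀ b' b * W c' c *
        kroneckerTensor (frameTensor K 2 3 ![0, 1, -1]) (frameTensor K 2 3 ![0, 1, -1]) a b c) =
      if γ a' + β b' + α c' = 2 then
        (if c' = a' ∧ b' = cls a'.1 a'.2 then (1 : K) else 0) else 0 := by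
    intro a' b' c'
    simp only [V, W]
    rw [sum_frameSq_sandwich (![0, 1, -1] : Fin 3 → K) v B₀ a' c' b']
    by_cases hac : a' = c'
    · subst hac
      obtain ⟨z, z'⟩ := a'
      fin_cases z <;> fin_cases z' <;> fin_cases b' <;>
        simp [γ, β, α, cls, gT, v, vT, B₀, T, Fintype.sum_prod_type, Fin.sum_univ_two] <;> norm_num
    · have hca : ¬ (c' = a') := fun h => hac h.symm
      simp [hac, hca]
  have ht : ∀ a' b' c', γ a' + β b' + α c' ≠ 2 →
      (if c' = a' ∧ b' = cls a'.1 a'.2 then (1 : K) else 0) = 0 := by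
    intro a' b' c' hw
    obtain ⟨z, z'⟩ := a'
    split_ifs with hcond
    · exfalso
      apply hw
      obtain ⟨-, rfl⟩ := hcond
      fin_cases z <;> fin_cases z' <;> simp [γ, β, α, cls, gT]
    · rfl
  exact ⟨2, _, _, _, isApproxRestriction_of_monomialWeights hM ht⟩

/-! ## §4 `(5,3,1)` by merging two classes of `(4,3,1,1)` -/

/-- **Merging classes is a restriction: `T_(4,3,1,1) ≥ T_(5,3,1)`** (every field; one-hot matrices).  The class map
of `(5,3,1)` — subgrid `∪ {(0,1)} ↦ 0`, `(0,0), (0,2), (2,0) ↦ 1`, `(1,0) ↦ 2` — is `merge ∘ cls_(4,3,1,1)` with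
`merge = (0 ↦ 0, 1 ↦ 1, 2 ↦ 0, 3 ↦ 2)`; the multiplier matrix is the indicator of `merge`, the position matrices
are identities. [cite: BurgisserClausenShokrollahi1997, (15.20)] -/
theorem list4311_restrictsTo_list531 :
    TensorRestrictsTo
      (fun (z : Fin 3 × Fin 3) (σ : Fin 4) (y : Fin 3 × Fin 3) =>
        if y = z ∧ σ = (![![1, 2, 1], ![3, 0, 0], ![1, 0, 0]] : Fin 3 → Fin 3 → Fin 4) z.1 z.2
        then (1 : K) else 0)
      (fun (z : Fin 3 × Fin 3) (σ : Fin 3) (y : Fin 3 × Fin 3) =>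
        if y = z ∧ σ = (![![1, 0, 1], ![2, 0, 0], ![1, 0, 0]] : Fin 3 → Fin 3 → Fin 3) z.1 z.2
        then (1 : K) else 0) := by
  classical
  let cls4 : Fin 3 → Fin 3 → Fin 4 := ![![1, 2, 1], ![3, 0, 0], ![1, 0, 0]]
  let cls3 : Fin 3 → Fin 3 → Fin 3 := ![![1, 0, 1], ![2, 0, 0], ![1, 0, 0]]
  let merge : Fin 4 → Fin 3 := ![0, 1, 0, 2]
  refine ⟨fun a' a => if a = a' then 1 else 0, fun b' b => if merge b = b' then 1 else 0,
    fun c' c => if c = c' then 1 else 0, fun a' b' c' => ?_⟩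
  rw [sum_oneHot_positions]
  by_cases hca : c' = a'
  · subst hca
    obtain ⟨z, z'⟩ := c'
    fin_cases z <;> fin_cases z' <;> fin_cases b' <;> simp [merge]
  · simp [hca]

/-- **`P_{2,3}(0,1,−1)^{⊠2} ⊴ ⟨1,1,5⟩ ⊕ ⟨1,1,3⟩ ⊕ ⟨1⟩` (characteristic `0`)**: §3 followed by the merging §4.  The
composed certificate has the multiplier row `λμ + ε²(λ − 1)` of MIXED order for the `5`-class: by hand (memo g36
§1, bottom lemma) no certificate with a single `ε`-weight per class exists for any partition of type `(5,3,1)`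
(a class all of whose points have the minimal depth has a closed complement, hence size `4, 6, 7, 8` or `9`).
[cite: BurgisserClausenShokrollahi1997, (15.25)] -/
theorem frameTensor_sq_degeneratesTo_list531 [CharZero K] :
    AlgDegeneratesTo
      (kroneckerTensor (frameTensor K 2 3 ![0, 1, -1]) (frameTensor K 2 3 ![0, 1, -1]))
      (fun (z : Fin 3 × Fin 3) (σ : Fin 3) (y : Fin 3 × Fin 3) =>
        if y = z ∧ σ = (![![1, 0, 1], ![2, 0, 0], ![1, 0, 0]] : Fin 3 → Fin 3 → Fin 3) z.1 z.2
        then (1 : K) else 0) :=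
  frameTensor_sq_degeneratesTo_list4311.trans_restrictsTo list4311_restrictsTo_list531

/-! ## §5 The inherited list: Theorem A squared -/

/-- **`P_{2,m}(λ)^{⊠2} ⊴ P_{2,m}(δ_{z₀})^{⊠2}`** (every field, every `m`, pairwise distinct nodes): the Kronecker square
of the gen-34 node collision (`AlgDegeneratesTo.kronecker`).  The target is the diagonal-type tensor with classes
`{z ≠ z₀}² | {z ≠ z₀} × {z₀} | {z₀} × {z ≠ z₀} | {(z₀,z₀)}` (multiplier vectors `(1,0)⊗(1,0)`, `(1,0)⊗(1,1)`,
`(1,1)⊗(1,0)`, `(1,1)⊗(1,1)`), i.e. the full list `((m−1)², m−1, m−1, 1)` — for `m = 3` the list `(4,2,2,1)`, whose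
mergings were the only full-list degenerations of the frame square known before gen 36.
[cite: BurgisserClausenShokrollahi1997, (15.25)] -/
theorem frameTensor_sq_degeneratesTo_indicator_sq {m : ℕ} {lam : Fin m → K}
    (hlam : Function.Injective lam) (z₀ : Fin m) :
    AlgDegeneratesTo
      (kroneckerTensor (frameTensor K 2 m lam) (frameTensor K 2 m lam))
      (kroneckerTensor (frameTensor K 2 m fun z => if z = z₀ then 1 else 0)
        (frameTensor K 2 m fun z => if z = z₀ then 1 else 0)) :=
  (frameTensor_degeneratesTo_frameTensor_indicator hlam z₀).kronecker
    (frameTensor_degeneratesTo_frameTensor_indicator hlam z₀)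

/-! ## The summit's field -/

/-- `P_{2,3}^{⊠2} ⊴ ⟨1,1,6⟩ ⊕ ⟨1⟩³` over `ℂ`. [cite: BurgisserClausenShokrollahi1997, (15.19)] -/
theorem frameTensor_sq_degeneratesTo_list6111_complex :
    AlgDegeneratesTo
      (kroneckerTensor (frameTensor ℂ 2 3 ![0, 1, -1]) (frameTensor ℂ 2 3 ![0, 1, -1]))
      (fun (z : Fin 3 × Fin 3) (σ : Fin 4) (y : Fin 3 × Fin 3) =>
        if y = z ∧ σ = (![![1, 0, 0], ![0, 2, 0], ![0, 0, 3]] : Fin 3 → Fin 3 → Fin 4) z.1 z.2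
        then (1 : ℂ) else 0) :=
  frameTensor_sq_degeneratesTo_list6111

/-- `P_{2,3}^{⊠2} ⊴ ⟨1,1,7⟩ ⊕ ⟨1⟩²` over `ℂ`. [cite: BurgisserClausenShokrollahi1997, (15.19)] -/
theorem frameTensor_sq_degeneratesTo_list711_complex :
    AlgDegeneratesTo
      (kroneckerTensor (frameTensor ℂ 2 3 ![0, 1, -1]) (frameTensor ℂ 2 3 ![0, 1, -1]))
      (fun (z : Fin 3 × Fin 3) (σ : Fin 3) (y : Fin 3 × Fin 3) =>
        if y = z ∧ σ = (![![0, 1, 0], ![2, 0, 0], ![0, 0, 0]] : Fin 3 → Fin 3 → Fin 3) z.1 z.2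
        then (1 : ℂ) else 0) :=
  frameTensor_sq_degeneratesTo_list711

/-- `P_{2,3}^{⊠2} ⊴ ⟨1,1,4⟩ ⊕ ⟨1,1,3⟩ ⊕ ⟨1⟩²` over `ℂ`. [cite: BurgisserClausenShokrollahi1997, (15.19)] -/
theorem frameTensor_sq_degeneratesTo_list4311_complex :
    AlgDegeneratesTo
      (kroneckerTensor (frameTensor ℂ 2 3 ![0, 1, -1]) (frameTensor ℂ 2 3 ![0, 1, -1]))
      (fun (z : Fin 3 × Fin 3) (σ : Fin 4) (y : Fin 3 × Fin 3) =>
        if y = z ∧ σ = (![![1, 2, 1], ![3, 0, 0], ![1, 0, 0]] : Fin 3 → Fin 3 → Fin 4) z.1 z.2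
        then (1 : ℂ) else 0) :=
  frameTensor_sq_degeneratesTo_list4311

/-- `P_{2,3}^{⊠2} ⊴ ⟨1,1,5⟩ ⊕ ⟨1,1,3⟩ ⊕ ⟨1⟩` over `ℂ`. [cite: BurgisserClausenShokrollahi1997, (15.25)] -/
theorem frameTensor_sq_degeneratesTo_list531_complex :
    AlgDegeneratesTo
      (kroneckerTensor (frameTensor ℂ 2 3 ![0, 1, -1]) (frameTensor ℂ 2 3 ![0, 1, -1]))
      (fun (z : Fin 3 × Fin 3) (σ : Fin 3) (y : Fin 3 × Fin 3) =>
        if y = z ∧ σ = (![![1, 0, 1], ![2, 0, 0], ![1, 0, 0]] : Fin 3 → Fin 3 → Fin 3) z.1 z.2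
        then (1 : ℂ) else 0) :=
  frameTensor_sq_degeneratesTo_list531

end Summit.MatrixMultiplication.MatrixMultiplication.Theorems.SaturationLadderFrameSquareDegenerations
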